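import Literature.NumberTheory.EllipticCurves.HeightsProofs
import Literature.NumberTheory.EllipticCurves.ReductionHomomorphism
import HarnessLib

/-!
# Néron's quasi-parallelogram law at a finite place, denominator form, for points of `E₀`

Trunk T-NT-EC (Literature/NumberTheory/EllipticCurves). Let `R` be a valuation ring of the field
`K` (as in `ReductionHomomorphism.lean`: a valuation `v : Valuation K Γ₀`, norm-like — `v ≤ 1` on
`R` — and `hv : v.Integers R`), `W` a Weierstrass equation with coefficients in `R`, and
`P = (x₁, y₁)`, `Q = (x₂, y₂)` two `K`-points of `W` with `x₁ ≠ x₂` (i.e. `P ≠ ±Q`) and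
NON-SINGULAR REDUCTION (`P, Q ∈ E₀(K)`). Writing `M(x) = max(1, v(x))` — for `K = ℚ` and the
`ℓ`-adic absolute value this is `ℓ^{ord_ℓ(den x)}`, the local denominator — the main theorem
`max_v_addX_mul_max_v_addX_neg_mul_v_sub_sq` is the identity

  `M(x(P + Q)) · M(x(P - Q)) · v(x₁ - x₂)² = M(x₁)² · M(x₂)²`,

additively `m(P+Q) + m(P-Q) = 2 m(P) + 2 m(Q) + 2 ord(x₁ - x₂)` with `m = max(0, -ord x)`. This
is the finite-place content of Néron's theory of local heights for points of the identity
component: `λ_v(P) = ½ max(0, -v(x(P))) + v(Δ)/12` on `E₀` (Silverman ATAEC Thm. VI.4.1) inserted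
in the quasi-parallelogram law `λ(P+Q) + λ(P-Q) = 2λ(P) + 2λ(Q) + v(x(P) - x(Q)) - v(Δ)/6`
(ATAEC Ex. 6.3); it is the local input `padicValNat_den_parallelogram` of the `p`-adic height
construction (`CanonicalPAdicHeightProofs.lean`, Mazur–Stein–Tate 2006 §2.4–2.6), whose
`ℚ`-specialisation is derived from this file elsewhere.

## Proof (elementary, from AEC VII.2.1 as formalised in `ReductionHomomorphism.lean`)

By cases on the reductions (`x(P + Q)`, `x(P - Q)` are Mathlib's chord formula `addX` at the
slopes through `P, Q` and `P, -Q`):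
* `P, Q ∈ E₁` (`v x₁, v x₂ > 1`): the polarised duplication numerator
  `x(P+Q) · x(P-Q) · (x₁ - x₂)² = x₁²x₂² - b₄x₁x₂ - b₆(x₁ + x₂) - b₈`
  (`addX_mul_addX_neg_mul_sub_sq`, repackaging `Point.numer_add_mul_numer_sub` of
  `HeightsProofs.lean`) has valuation `v(x₁)²v(x₂)²` (dominant term), and
  `P ± Q ∈ E₁` (`one_lt_v_addX_of_one_lt_of_X_ne`);
* exactly one of `P, Q` in `E₁`: `x(P ± Q) ≡ x` of the integral one (`v_addX_sub_X_lt_one`), and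
  `v(x₁ - x₂)` is the larger of `v x₁, v x₂`;
* both integral, `x̄₁ ≠ x̄₂`: the slopes are integral, everything is a unit;
* both integral, `x̄₁ = x̄₂`, so `P̃ = ±Q̃`: the chord through `P` and `∓Q` has slope
  `(unit)/(x₁ - x₂)`, so `v(x(P ± Q)) = v(x₁ - x₂)⁻²` (`v_addX_mul_v_sub_sq_eq_one`), while the
  other combination is integral by AEC Lemma VII.2.1.1 (`exists_add_eq_of_residue_eq`) — unless
  `P̃ = Q̃` has order `2`, where both `P ± Q ∈ E₁` (`reducesToZero_add_of_residue_eq`) and the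
  displayed product is a unit because its reduction is `φ₂(x̄) = Φ_x(P̃)²`
  (`phi_two_eq_sq_of_polynomialY_eq_zero`, from `Point.numer_two_mul_eq` of `HeightsProofs.lean`)
  and `P̃` is non-singular.

## Sources

* J. H. Silverman, *Advanced Topics in the Arithmetic of Elliptic Curves*, GTM 151 (1994),
  Thm. VI.4.1, Ex. 6.3 (the statement, as local heights).
* J. H. Silverman, *The Arithmetic of Elliptic Curves*, 2nd ed. (2009), III.2.3 (chord and
  duplication formulas), VII.2 Prop. 2.1 and Lemma 2.1.1 (PDF pp. 166–170 of the held copy).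
* B. Mazur, W. Stein, J. Tate, Doc. Math. Extra Vol. Coates (2006), §2.4 (`σ̃_v`, `λ_v`), §2.6.

## Design

Everything is stated on coordinates / `addX`, so that no group law (and no `DecidableEq`
instance) enters the statement of the main theorem; `P - Q` is `P + (x₂, -y₂ - a₁x₂ - a₃)`.
Namespace `Literature.NumberTheory.EllipticCurves` (generic valuation rings), chord identities in
the sub-namespace `WeierstrassCurve.Affine` as in `ReductionHomomorphism.lean`.
-/

noncomputable section

open scoped Classical

namespace Literature.NumberTheory.EllipticCurves

/-! ### Algebraic identities for the chord law (repackaged from `HeightsProofs.lean`) -/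

namespace WeierstrassCurve.Affine

variable {F : Type*} [Field F] (W : WeierstrassCurve.Affine F)

/-- `x(P + Q) = x(Q + P)` on the nose for the chord formulas: `addX` and the chord slope are
symmetric. [folklore] -/
theorem addX_slope_comm {x₁ x₂ y₁ y₂ : F} (hx : x₁ ≠ x₂) :
    W.addX x₁ x₂ (W.slope x₁ x₂ y₁ y₂) = W.addX x₂ x₁ (W.slope x₂ x₁ y₂ y₁) := by
  rw [WeierstrassCurve.Affine.slope_of_X_ne hx, WeierstrassCurve.Affine.slope_of_X_ne hx.symm,
    WeierstrassCurve.Affine.addX, WeierstrassCurve.Affine.addX, ← neg_sub y₁ y₂, ← neg_sub x₁ x₂,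
    neg_div_neg_eq]
  ring

/-- **The `x`-coordinates of `P + Q` and `P - Q`**: for `P = (x₁, y₁)`, `Q = (x₂, y₂)` on `W` with
`x₁ ≠ x₂`, `x(P+Q) · x(P-Q) · (x₁ - x₂)² = x₁²x₂² - b₄x₁x₂ - b₆(x₁ + x₂) - b₈`
(`P - Q = P + (x₂, -y₂ - a₁x₂ - a₃)`); the tree's `Point.addX_slope_eq_div` and
`Point.numer_add_mul_numer_sub` (`HeightsProofs.lean`, AEC proof of VIII.6.2) with the
denominators cleared. [Silverman AEC III.2.3, proof of VIII.6.2] [folklore] -/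
theorem addX_mul_addX_neg_mul_sub_sq {V : WeierstrassCurve F} {x₁ x₂ y₁ y₂ : F}
    (h₁ : V.toAffine.Equation x₁ y₁) (h₂ : V.toAffine.Equation x₂ y₂) (hx : x₁ ≠ x₂) :
    V.toAffine.addX x₁ x₂ (V.toAffine.slope x₁ x₂ y₁ y₂) *
        V.toAffine.addX x₁ x₂ (V.toAffine.slope x₁ x₂ y₁ (V.toAffine.negY x₂ y₂)) *
        (x₁ - x₂) ^ 2 =
      x₁ ^ 2 * x₂ ^ 2 - V.b₄ * x₁ * x₂ - V.b₆ * (x₁ + x₂) - V.b₈ := by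
  have hD : x₁ - x₂ ≠ 0 := sub_ne_zero.mpr hx
  have key := WeierstrassCurve.Affine.Point.numer_add_mul_numer_sub h₁ h₂
  rw [WeierstrassCurve.Affine.Point.addX_slope_eq_div y₁ y₂ hx,
    WeierstrassCurve.Affine.Point.addX_slope_eq_div y₁ (V.toAffine.negY x₂ y₂) hx]
  field_simp
  linear_combination key

end WeierstrassCurve.Affine

/-- **The numerator of the duplication formula at a point of order `2`** is `Φ_x²`: for `(x, y)`
on `V` (over a field) with `Φ_y(x, y) = 2y + a₁x + a₃ = 0`,
`x⁴ - b₄x² - 2b₆x - b₈ = Φ_x(x, y)²` — the tree's `Point.numer_two_mul_eq` (`HeightsProofs.lean`: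
`φ₂ = Φ_x² - a₁Φ_xΦ_y - (a₂ + 2x)Φ_y²` on the curve) at `Φ_y = 0`; in particular it is non-zero iff
the point is non-singular. [Silverman AEC III.2.3(d)] [folklore] -/
theorem phi_two_eq_sq_of_polynomialY_eq_zero {F : Type*} [Field F] (V : WeierstrassCurve F)
    {x y : F} (h : V.toAffine.Equation x y) (hy : V.toAffine.polynomialY.evalEval x y = 0) :
    x ^ 4 - V.b₄ * x ^ 2 - 2 * V.b₆ * x - V.b₈ = (V.toAffine.polynomialX.evalEval x y) ^ 2 := by
  have key := WeierstrassCurve.Affine.Point.numer_two_mul_eq h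
  rw [WeierstrassCurve.Affine.evalEval_polynomialY] at hy
  rw [WeierstrassCurve.Affine.evalEval_polynomialX]
  have hy' : y - V.toAffine.negY x y = 0 := by rw [WeierstrassCurve.Affine.negY, ← hy]; ring
  rw [hy'] at key
  linear_combination -key

/-! ### Valuation estimates -/

section Valuation

variable {K : Type*} [Field K] {Γ₀ : Type*} [LinearOrderedCommGroupWithZero Γ₀]
  {v : Valuation K Γ₀} {R : Type*} [CommRing R] [Algebra R K] {W : WeierstrassCurve R}

/-- **Dominant term.** For `x₁, x₂` non-integral, `v(x₁²x₂² - b₄x₁x₂ - b₆(x₁ + x₂) - b₈) =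
v(x₁)² v(x₂)²` (integral coefficients). [folklore] -/
theorem v_xPoly_eq_of_one_lt (hv : v.Integers R) {x₁ x₂ : K} (hx₁ : 1 < v x₁) (hx₂ : 1 < v x₂) :
    v (x₁ ^ 2 * x₂ ^ 2 - (W.baseChange K).b₄ * x₁ * x₂ - (W.baseChange K).b₆ * (x₁ + x₂) -
        (W.baseChange K).b₈) = v x₁ ^ 2 * v x₂ ^ 2 := by
  have h1 := hv.map_le_one
  have hb₄ : v (W.baseChange K).b₄ ≤ 1 := by
    rw [WeierstrassCurve.baseChange, WeierstrassCurve.map_b₄]; exact h1 _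
  have hb₆ : v (W.baseChange K).b₆ ≤ 1 := by
    rw [WeierstrassCurve.baseChange, WeierstrassCurve.map_b₆]; exact h1 _
  have hb₈ : v (W.baseChange K).b₈ ≤ 1 := by
    rw [WeierstrassCurve.baseChange, WeierstrassCurve.map_b₈]; exact h1 _
  have ha : 1 < v x₁ * v x₂ := one_lt_mul'' hx₁ hx₂
  have hA : v (x₁ ^ 2 * x₂ ^ 2) = (v x₁ * v x₂) ^ 2 := by
    rw [map_mul, map_pow, map_pow, mul_pow]
  have ha2 : v x₁ * v x₂ < (v x₁ * v x₂) ^ 2 := by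
    conv_lhs => rw [← pow_one (v x₁ * v x₂)]
    exact pow_lt_pow_right₀ ha one_lt_two
  have hB : v ((W.baseChange K).b₄ * x₁ * x₂) < v (x₁ ^ 2 * x₂ ^ 2) := by
    rw [hA, map_mul, map_mul, mul_assoc]
    calc v (W.baseChange K).b₄ * (v x₁ * v x₂) ≤ 1 * (v x₁ * v x₂) := by gcongr
      _ = v x₁ * v x₂ := one_mul _
      _ < (v x₁ * v x₂) ^ 2 := ha2
  have hAB : v (x₁ ^ 2 * x₂ ^ 2 - (W.baseChange K).b₄ * x₁ * x₂) = (v x₁ * v x₂) ^ 2 := by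
    rw [Valuation.map_sub_eq_of_lt_left _ hB, hA]
  have hmax : max (v x₁) (v x₂) ≤ v x₁ * v x₂ :=
    max_le (le_mul_of_one_le_right' hx₂.le) (le_mul_of_one_le_left' hx₁.le)
  have hC : v ((W.baseChange K).b₆ * (x₁ + x₂)) <
      v (x₁ ^ 2 * x₂ ^ 2 - (W.baseChange K).b₄ * x₁ * x₂) := by
    rw [hAB, map_mul]
    calc v (W.baseChange K).b₆ * v (x₁ + x₂) ≤ 1 * max (v x₁) (v x₂) := by
          gcongr; exact v.map_add x₁ x₂
      _ ≤ v x₁ * v x₂ := by rw [one_mul]; exact hmax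
      _ < (v x₁ * v x₂) ^ 2 := ha2
  have hABC : v (x₁ ^ 2 * x₂ ^ 2 - (W.baseChange K).b₄ * x₁ * x₂ - (W.baseChange K).b₆ * (x₁ + x₂))
      = (v x₁ * v x₂) ^ 2 := by
    rw [Valuation.map_sub_eq_of_lt_left _ hC, hAB]
  have hD : v (W.baseChange K).b₈ <
      v (x₁ ^ 2 * x₂ ^ 2 - (W.baseChange K).b₄ * x₁ * x₂ - (W.baseChange K).b₆ * (x₁ + x₂)) := by
    rw [hABC]
    exact hb₈.trans_lt (one_lt_pow₀ ha two_ne_zero)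
  rw [Valuation.map_sub_eq_of_lt_left _ hD, hABC, mul_pow]

/-- **Exact valuation of `x(P + Q)` when the slope is non-integral** and `x₁, x₂` are integral:
`v(λ² + a₁λ - a₂ - x₁ - x₂) = v(λ)²`. [folklore] -/
theorem v_addX_eq_of_one_lt_v_slope' (hv : v.Integers R) {x₁ x₂ L : K} (hx₁ : v x₁ ≤ 1)
    (hx₂ : v x₂ ≤ 1) (hL : 1 < v L) :
    v ((W.baseChange K).toAffine.addX x₁ x₂ L) = v L ^ 2 := by
  have h1 := hv.map_le_one
  have ha₁ : v (W.baseChange K).toAffine.a₁ ≤ 1 := by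
    simp only [WeierstrassCurve.baseChange, WeierstrassCurve.map_a₁]; exact h1 _
  have ha₂ : v (W.baseChange K).toAffine.a₂ ≤ 1 := by
    simp only [WeierstrassCurve.baseChange, WeierstrassCurve.map_a₂]; exact h1 _
  have hL2 : v L < v L ^ 2 := by
    conv_lhs => rw [← pow_one (v L)]
    exact pow_lt_pow_right₀ hL one_lt_two
  have h1L2 : (1 : Γ₀) < v L ^ 2 := one_lt_pow₀ hL two_ne_zero
  rw [WeierstrassCurve.Affine.addX]
  have e1 : v (L ^ 2 + (W.baseChange K).toAffine.a₁ * L) = v L ^ 2 := by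
    rw [Valuation.map_add_eq_of_lt_left, map_pow]
    rw [map_pow, map_mul]
    calc v (W.baseChange K).toAffine.a₁ * v L ≤ 1 * v L := by gcongr
      _ = v L := one_mul _
      _ < v L ^ 2 := hL2
  have e2 : v (L ^ 2 + (W.baseChange K).toAffine.a₁ * L - (W.baseChange K).toAffine.a₂) = v L ^ 2 := by
    rw [Valuation.map_sub_eq_of_lt_left _ (by rw [e1]; exact ha₂.trans_lt h1L2), e1]
  have e3 : v (L ^ 2 + (W.baseChange K).toAffine.a₁ * L - (W.baseChange K).toAffine.a₂ - x₁) =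
      v L ^ 2 := by
    rw [Valuation.map_sub_eq_of_lt_left _ (by rw [e2]; exact hx₁.trans_lt h1L2), e2]
  rw [Valuation.map_sub_eq_of_lt_left _ (by rw [e3]; exact hx₂.trans_lt h1L2), e3]

/-- `x(P + Q)` is integral when `x₁, x₂` and the slope are. [folklore] -/
theorem v_addX_le_one (hv : v.Integers R) {x₁ x₂ L : K} (hx₁ : v x₁ ≤ 1) (hx₂ : v x₂ ≤ 1)
    (hL : v L ≤ 1) : v ((W.baseChange K).toAffine.addX x₁ x₂ L) ≤ 1 := by
  have h1 := hv.map_le_one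
  have ha₁ : v (W.baseChange K).toAffine.a₁ ≤ 1 := by
    simp only [WeierstrassCurve.baseChange, WeierstrassCurve.map_a₁]; exact h1 _
  have ha₂ : v (W.baseChange K).toAffine.a₂ ≤ 1 := by
    simp only [WeierstrassCurve.baseChange, WeierstrassCurve.map_a₂]; exact h1 _
  rw [WeierstrassCurve.Affine.addX]
  refine v.map_sub_le (v.map_sub_le (v.map_sub_le (v.map_add_le ?_ ?_) ha₂) hx₁) hx₂
  · rw [map_pow]; exact pow_le_one₀ zero_le hL
  · rw [map_mul]; exact mul_le_one' ha₁ hL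

/-- An integral `x`-coordinate differs from another one by a difference of valuation `≤ 1`; used
as `v (x₃ - x₂) < 1 → v x₂ ≤ 1 → v x₃ ≤ 1`. [folklore] -/
theorem v_le_one_of_v_sub_lt_one {a b : K} (h : v (a - b) < 1) (hb : v b ≤ 1) : v a ≤ 1 := by
  have : a = a - b + b := by ring
  rw [this]
  exact Valuation.map_add_le _ h.le hb

end Valuation

/-! ### The local law -/

section Law

variable {K : Type*} [Field K] {Γ₀ : Type*} [LinearOrderedCommGroupWithZero Γ₀]
  {v : Valuation K Γ₀} {R : Type*} [CommRing R] [IsLocalRing R] [Algebra R K]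
  {W : WeierstrassCurve R}

omit [IsLocalRing R] in
/-- If `P + Q` has integral coordinates then `v(x(P + Q)) ≤ 1` (for `x(P) ≠ x(Q)`, in terms of the
chord formula). [folklore] -/
theorem v_addX_le_one_of_add_eq_some (hv : v.Integers R) {x₁ x₂ y₁ y₂ : K}
    {h₁ : (W.baseChange K).toAffine.Nonsingular x₁ y₁} {h₂ : (W.baseChange K).toAffine.Nonsingular x₂ y₂}
    {a₃ b₃ : R} {h₃ : (W.baseChange K).toAffine.Nonsingular (algebraMap R K a₃) (algebraMap R K b₃)}
    (hx : x₁ ≠ x₂)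
    (hsum : (.some x₁ y₁ h₁ : (W.baseChange K).toAffine.Point) + .some x₂ y₂ h₂ = .some _ _ h₃) :
    v ((W.baseChange K).toAffine.addX x₁ x₂ ((W.baseChange K).toAffine.slope x₁ x₂ y₁ y₂)) ≤ 1 := by
  rw [WeierstrassCurve.Affine.Point.add_of_X_ne hx] at hsum
  obtain ⟨hX, -⟩ := WeierstrassCurve.Affine.Point.some.inj hsum
  rw [hX]; exact hv.map_le_one a₃

omit [IsLocalRing R] in
/-- If `P + Q` reduces to `O` then `v(x(P + Q)) > 1` (for `x(P) ≠ x(Q)`). [folklore] -/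
theorem one_lt_v_addX_of_reducesToZero_add (hv : v.Integers R) {x₁ x₂ y₁ y₂ : K}
    {h₁ : (W.baseChange K).toAffine.Nonsingular x₁ y₁} {h₂ : (W.baseChange K).toAffine.Nonsingular x₂ y₂}
    (hx : x₁ ≠ x₂)
    (hZ : WeierstrassCurve.ReducesToZero W ((.some x₁ y₁ h₁ : (W.baseChange K).toAffine.Point) + .some x₂ y₂ h₂)) :
    1 < v ((W.baseChange K).toAffine.addX x₁ x₂ ((W.baseChange K).toAffine.slope x₁ x₂ y₁ y₂)) := by
  rw [WeierstrassCurve.Affine.Point.add_of_X_ne hx, WeierstrassCurve.reducesToZero_some_iff,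
    not_mem_range_iff hv] at hZ
  exact hZ

/-- **Unit numerator, non-unit denominator.** For integral points with `x̄₁ = x̄₂`, `x₁ ≠ x₂`, and a
chord slope `λ = n/(x₁ - x₂)` with `n` a unit: `v(x(P+Q)) = v(λ)² = v(x₁ - x₂)⁻² > 1`.
[Silverman AEC VII.2.1 (case `P̃ = -Q̃`)] [folklore] -/
theorem v_addX_mul_v_sub_sq_eq_one (hv : v.Integers R) {p₁ p₂ n : R}
    (hres : IsLocalRing.residue R p₁ = IsLocalRing.residue R p₂) (hp : p₁ ≠ p₂)
    (hn : IsLocalRing.residue R n ≠ 0) :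
    1 < v ((W.baseChange K).toAffine.addX (algebraMap R K p₁) (algebraMap R K p₂)
      (algebraMap R K n / algebraMap R K (p₁ - p₂))) ∧
    v ((W.baseChange K).toAffine.addX (algebraMap R K p₁) (algebraMap R K p₂)
      (algebraMap R K n / algebraMap R K (p₁ - p₂))) *
        v (algebraMap R K p₁ - algebraMap R K p₂) ^ 2 = 1 := by
  have hinj := hv.hom_inj
  have h1 := hv.map_le_one
  have hvn : v (algebraMap R K n) = 1 := (v_algebraMap_eq_one_iff hv n).mpr hn
  have hvD : v (algebraMap R K (p₁ - p₂)) < 1 :=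
    (v_algebraMap_lt_one_iff hv _).mpr (by rw [map_sub, sub_eq_zero]; exact hres)
  have hvD0 : v (algebraMap R K (p₁ - p₂)) ≠ 0 := by
    rw [Valuation.ne_zero_iff]
    intro h
    exact hp (sub_eq_zero.mp (hinj (by rw [h, map_zero])))
  have hL : 1 < v (algebraMap R K n / algebraMap R K (p₁ - p₂)) := by
    rw [map_div₀, hvn, one_div]
    exact (one_lt_inv₀ (zero_lt_iff.mpr hvD0)).mpr hvD
  have hX := v_addX_eq_of_one_lt_v_slope' (W := W) hv (h1 p₁) (h1 p₂) hL
  refine ⟨hX ▸ one_lt_pow₀ hL two_ne_zero, ?_⟩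
  rw [hX, map_div₀, hvn, ← map_sub, one_div, inv_pow, inv_mul_cancel₀ (pow_ne_zero 2 hvD0)]

/-- **Néron's quasi-parallelogram law at a finite place, in valuation form.** Let `R` be a
valuation ring of `K` (`hv`), `W` a Weierstrass equation with coefficients in `R`, and `P = (x₁, y₁)`,
`Q = (x₂, y₂)` two `K`-points with `x₁ ≠ x₂` and non-singular reduction (`P, Q ∈ E₀(K)`). With
`M(x) = max(1, v(x))` (the "denominator" of `x`):
`M(x(P+Q)) · M(x(P-Q)) · v(x₁ - x₂)² = M(x₁)² · M(x₂)²`,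
i.e. additively `m(P+Q) + m(P-Q) = 2m(P) + 2m(Q) + 2 ord(x₁ - x₂)`, `m = max(0, -ord x)`. This is
the denominator form of `λ(P+Q) + λ(P-Q) = 2λ(P) + 2λ(Q) + v(x(P) - x(Q)) - v(Δ)/6` with
`λ = ½ max(0, -v(x)) + v(Δ)/12` on `E₀` (Silverman ATAEC VI.4.1, Ex. 6.3), proved here directly
from AEC VII.2.1: if `P, Q ∈ E₁` use `x(P+Q)x(P-Q)(x₁-x₂)² = x₁²x₂² - b₄x₁x₂ - b₆(x₁+x₂) - b₈`
and `E₁ + E₁ ⊆ E₁`; if exactly one of them is in `E₁` then `x(P ± Q) ≡ x(Q)`; if both are integral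
with `x̄₁ ≠ x̄₂` everything is a unit; if `x̄₁ = x̄₂` then `P̃ = ±Q̃` and the chord through `P, ∓Q`
has slope of valuation `v(x₁ - x₂)⁻¹` while `P ± Q` is integral (AEC VII.2.1.1), except when
`P̃ = Q̃` has order `2`, where both `P ± Q ∈ E₁` and the displayed product is a unit because its
reduction is `φ₂(x̄) = Φ_x(P̃)² ≠ 0`. [Silverman ATAEC VI.4.1, Ex. 6.3; Silverman AEC VII.2.1]
[cite: SilvermanATAEC1994, VI.4.1 and Ex. 6.3] -/
theorem max_v_addX_mul_max_v_addX_neg_mul_v_sub_sq (hv : v.Integers R) {x₁ x₂ y₁ y₂ : K}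
    (h₁ : (W.baseChange K).toAffine.Nonsingular x₁ y₁) (h₂ : (W.baseChange K).toAffine.Nonsingular x₂ y₂)
    (hx : x₁ ≠ x₂) (hP : WeierstrassCurve.HasNonsingularReduction W (.some _ _ h₁))
    (hQ : WeierstrassCurve.HasNonsingularReduction W (.some _ _ h₂)) :
    max 1 (v ((W.baseChange K).toAffine.addX x₁ x₂ ((W.baseChange K).toAffine.slope x₁ x₂ y₁ y₂))) *
      max 1 (v ((W.baseChange K).toAffine.addX x₁ x₂ ((W.baseChange K).toAffine.slope x₁ x₂ y₁
        ((W.baseChange K).toAffine.negY x₂ y₂)))) * v (x₁ - x₂) ^ 2 =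
      max 1 (v x₁) ^ 2 * max 1 (v x₂) ^ 2 := by
  have hinj := hv.hom_inj
  have h1 := hv.map_le_one
  have h₂' : (W.baseChange K).toAffine.Nonsingular x₂ ((W.baseChange K).toAffine.negY x₂ y₂) :=
    (WeierstrassCurve.Affine.nonsingular_neg _ _).mpr h₂
  rcases lt_or_ge 1 (v x₁) with hx₁ | hx₁ <;> rcases lt_or_ge 1 (v x₂) with hx₂ | hx₂
  · -- (A) `P, Q ∈ E₁`
    have hx₃ := one_lt_v_addX_of_one_lt_of_X_ne hv h₁.1 h₂.1 hx₁ hx₂ hx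
    have hx₄ := one_lt_v_addX_of_one_lt_of_X_ne hv h₁.1 h₂'.1 hx₁ hx₂ hx
    have prod := congrArg v
      (WeierstrassCurve.Affine.addX_mul_addX_neg_mul_sub_sq (V := W.baseChange K) h₁.1 h₂.1 hx)
    rw [map_mul, map_mul, map_pow] at prod
    rw [max_eq_right hx₃.le, max_eq_right hx₄.le, max_eq_right hx₁.le, max_eq_right hx₂.le, prod]
    exact v_xPoly_eq_of_one_lt hv hx₁ hx₂
  · -- (B) `P ∈ E₁`, `Q` integral
    have hx₃ := v_le_one_of_v_sub_lt_one (v_addX_sub_X_lt_one hv h₁.1 h₂.1 hx₁ hx₂) hx₂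
    have hx₄ := v_le_one_of_v_sub_lt_one (v_addX_sub_X_lt_one hv h₁.1 h₂'.1 hx₁ hx₂) hx₂
    have hvD : v (x₁ - x₂) = v x₁ := Valuation.map_sub_eq_of_lt_left _ (hx₂.trans_lt hx₁)
    rw [max_eq_left hx₃, max_eq_left hx₄, max_eq_right hx₁.le, max_eq_left hx₂, hvD, one_mul, one_mul,
      one_pow, mul_one]
  · -- (B') `Q ∈ E₁`, `P` integral
    have hx₃ : v ((W.baseChange K).toAffine.addX x₁ x₂
        ((W.baseChange K).toAffine.slope x₁ x₂ y₁ y₂)) ≤ 1 := by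
      rw [WeierstrassCurve.Affine.addX_slope_comm _ hx]
      exact v_le_one_of_v_sub_lt_one (v_addX_sub_X_lt_one hv h₂.1 h₁.1 hx₂ hx₁) hx₁
    have hx₄ : v ((W.baseChange K).toAffine.addX x₁ x₂ ((W.baseChange K).toAffine.slope x₁ x₂ y₁
        ((W.baseChange K).toAffine.negY x₂ y₂))) ≤ 1 := by
      rw [WeierstrassCurve.Affine.addX_slope_comm _ hx]
      exact v_le_one_of_v_sub_lt_one (v_addX_sub_X_lt_one hv h₂'.1 h₁.1 hx₂ hx₁) hx₁
    have hvD : v (x₁ - x₂) = v x₂ := Valuation.map_sub_eq_of_lt_right _ (hx₁.trans_lt hx₂)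
    rw [max_eq_left hx₃, max_eq_left hx₄, max_eq_left hx₁, max_eq_right hx₂.le, hvD, one_mul, one_mul,
      one_pow, one_mul]
  · -- (C) both integral
    obtain ⟨p₁, rfl⟩ := hv.exists_of_le_one hx₁
    obtain ⟨q₁, rfl⟩ := hv.exists_of_le_one (v_Y_le_one_of_v_X_le_one hv h₁.1 hx₁)
    obtain ⟨p₂, rfl⟩ := hv.exists_of_le_one hx₂
    obtain ⟨q₂, rfl⟩ := hv.exists_of_le_one (v_Y_le_one_of_v_X_le_one hv h₂.1 hx₂)
    have hp : p₁ ≠ p₂ := fun h => hx (by rw [h])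
    have hnsP := (WeierstrassCurve.hasNonsingularReduction_some_algebraMap_iff hinj h₁).mp hP
    have hnsQ := (WeierstrassCurve.hasNonsingularReduction_some_algebraMap_iff hinj h₂).mp hQ
    rw [max_eq_left hx₁, max_eq_left hx₂, one_pow, one_mul]
    have hnegY : (W.baseChange K).toAffine.negY (algebraMap R K p₂) (algebraMap R K q₂) =
        algebraMap R K (W.toAffine.negY p₂ q₂) := baseChange_negY_algebraMap p₂ q₂
    have hslopeS : (W.baseChange K).toAffine.slope (algebraMap R K p₁) (algebraMap R K p₂)
        (algebraMap R K q₁) (algebraMap R K q₂) =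
          algebraMap R K (q₁ - q₂) / algebraMap R K (p₁ - p₂) :=
      baseChange_slope_eq_div_of_X_ne hinj hp
    have hslopeD : (W.baseChange K).toAffine.slope (algebraMap R K p₁) (algebraMap R K p₂)
        (algebraMap R K q₁) (algebraMap R K (W.toAffine.negY p₂ q₂)) =
          algebraMap R K (q₁ - W.toAffine.negY p₂ q₂) / algebraMap R K (p₁ - p₂) :=
      baseChange_slope_eq_div_of_X_ne hinj hp
    have h₂'' : (W.baseChange K).toAffine.Nonsingular (algebraMap R K p₂)
        (algebraMap R K (W.toAffine.negY p₂ q₂)) := by rw [← hnegY]; exact h₂'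
    by_cases hres : IsLocalRing.residue R p₁ = IsLocalRing.residue R p₂
    · -- (C2) `x̄₁ = x̄₂`: `P̃ = ±Q̃`
      have hnsQ' : (W.map (IsLocalRing.residue R)).toAffine.Nonsingular (IsLocalRing.residue R p₂)
          (IsLocalRing.residue R (W.toAffine.negY p₂ q₂)) := by
        rw [← map_residue_negY]; exact (WeierstrassCurve.Affine.nonsingular_neg _ _).mpr hnsQ
      have hnn : IsLocalRing.residue R (W.toAffine.negY p₂ q₂) =
          (W.map (IsLocalRing.residue R)).toAffine.negY (IsLocalRing.residue R p₂)
            (IsLocalRing.residue R q₂) := (map_residue_negY p₂ q₂).symm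
      rw [hnegY]
      by_cases hyneg : IsLocalRing.residue R q₁ = (W.map (IsLocalRing.residue R)).toAffine.negY
          (IsLocalRing.residue R p₂) (IsLocalRing.residue R q₂)
      · by_cases hyeq : IsLocalRing.residue R q₁ = IsLocalRing.residue R q₂
        · -- (C2c) `P̃ = Q̃` of order `2`: both sums in `E₁`
          have hZS := one_lt_v_addX_of_reducesToZero_add hv hx
            (WeierstrassCurve.reducesToZero_add_of_residue_eq hv h₁ h₂ hnsP hres hyneg)
          have hyneg' : IsLocalRing.residue R q₁ = (W.map (IsLocalRing.residue R)).toAffine.negY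
              (IsLocalRing.residue R p₂) (IsLocalRing.residue R (W.toAffine.negY p₂ q₂)) := by
            rw [hnn, WeierstrassCurve.Affine.negY_negY]; exact hyeq
          have hZD := one_lt_v_addX_of_reducesToZero_add hv hx
            (WeierstrassCurve.reducesToZero_add_of_residue_eq hv h₁ h₂'' hnsP hres hyneg')
          rw [max_eq_right hZS.le, max_eq_right hZD.le]
          have prod := congrArg v (WeierstrassCurve.Affine.addX_mul_addX_neg_mul_sub_sq
            (V := W.baseChange K) h₁.1 h₂.1 hx)
          rw [hnegY, map_mul, map_mul, map_pow] at prod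
          rw [prod]
          -- the product is a unit: its reduction is `φ₂(x̄) = Φ_x(P̃)² ≠ 0`
          have hpoly : (algebraMap R K p₁) ^ 2 * (algebraMap R K p₂) ^ 2 -
              (W.baseChange K).toAffine.b₄ * (algebraMap R K p₁) * (algebraMap R K p₂) -
              (W.baseChange K).toAffine.b₆ * (algebraMap R K p₁ + algebraMap R K p₂) -
              (W.baseChange K).toAffine.b₈ =
                algebraMap R K (p₁ ^ 2 * p₂ ^ 2 - W.b₄ * p₁ * p₂ - W.b₆ * (p₁ + p₂) - W.b₈) := by
            simp only [map_sub, map_mul, map_pow, map_add, WeierstrassCurve.baseChange,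
              WeierstrassCurve.map_b₄, WeierstrassCurve.map_b₆, WeierstrassCurve.map_b₈]
          rw [hpoly, v_algebraMap_eq_one_iff hv]
          have hΦy : (W.map (IsLocalRing.residue R)).toAffine.polynomialY.evalEval
              (IsLocalRing.residue R p₁) (IsLocalRing.residue R q₁) = 0 := by
            rw [← residue_polynomialY, map_sub, ← map_residue_negY, sub_eq_zero]
            conv_rhs => rw [hres, hyeq]
            exact hyneg
          have hΦx := hnsP.2.resolve_right (fun h => h hΦy)
          have key := phi_two_eq_sq_of_polynomialY_eq_zero (W.map (IsLocalRing.residue R)) hnsP.1 hΦy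
          simp only [map_sub, map_mul, map_pow, map_add, ← hres]
          have e : IsLocalRing.residue R p₁ ^ 2 * IsLocalRing.residue R p₁ ^ 2 -
              (IsLocalRing.residue R) W.b₄ * IsLocalRing.residue R p₁ * IsLocalRing.residue R p₁ -
              (IsLocalRing.residue R) W.b₆ * (IsLocalRing.residue R p₁ + IsLocalRing.residue R p₁) -
              (IsLocalRing.residue R) W.b₈ =
                IsLocalRing.residue R p₁ ^ 4 - (W.map (IsLocalRing.residue R)).b₄ *
                  IsLocalRing.residue R p₁ ^ 2 - 2 * (W.map (IsLocalRing.residue R)).b₆ *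
                  IsLocalRing.residue R p₁ - (W.map (IsLocalRing.residue R)).b₈ := by
            simp only [WeierstrassCurve.map_b₄, WeierstrassCurve.map_b₆, WeierstrassCurve.map_b₈]
            ring
          rw [e, key]
          exact pow_ne_zero 2 hΦx
        · -- (C2b) `P̃ = -Q̃ ≠ Q̃`: `P + Q ∈ E₁` with exact valuation, `P - Q` integral
          have hn : IsLocalRing.residue R (q₁ - q₂) ≠ 0 := by rwa [map_sub, sub_ne_zero]
          obtain ⟨hS1, hS⟩ := v_addX_mul_v_sub_sq_eq_one (W := W) hv hres hp hn
          rw [← hslopeS] at hS1 hS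
          have hyneg' : IsLocalRing.residue R q₁ ≠ (W.map (IsLocalRing.residue R)).toAffine.negY
              (IsLocalRing.residue R p₂) (IsLocalRing.residue R (W.toAffine.negY p₂ q₂)) := by
            rw [hnn, WeierstrassCurve.Affine.negY_negY]; exact hyeq
          obtain ⟨a₃, b₃, h₃, hsum, -, -⟩ := WeierstrassCurve.exists_add_eq_of_residue_eq hv h₁ h₂'' hnsP hnsQ' hres hyneg'
          have hD := v_addX_le_one_of_add_eq_some hv hx hsum
          rw [max_eq_right hS1.le, max_eq_left hD, mul_one, hS]
      · -- (C2a) `P̃ = Q̃ ≠ -Q̃`: `P + Q` integral, `P - Q ∈ E₁` with exact valuation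
        obtain ⟨a₃, b₃, h₃, hsum, -, -⟩ := WeierstrassCurve.exists_add_eq_of_residue_eq hv h₁ h₂ hnsP hnsQ hres hyneg
        have hS := v_addX_le_one_of_add_eq_some hv hx hsum
        have hn : IsLocalRing.residue R (q₁ - W.toAffine.negY p₂ q₂) ≠ 0 := by
          rwa [map_sub, ← map_residue_negY, sub_ne_zero]
        obtain ⟨hD1, hD⟩ := v_addX_mul_v_sub_sq_eq_one (W := W) hv hres hp hn
        rw [← hslopeD] at hD1 hD
        rw [max_eq_left hS, max_eq_right hD1.le, one_mul, hD]
    · -- (C1) `x̄₁ ≠ x̄₂`: everything integral, `x₁ - x₂` a unit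
      have hvD : v (algebraMap R K p₁ - algebraMap R K p₂) = 1 := by
        rw [← map_sub, v_algebraMap_eq_one_iff hv]; rwa [map_sub, sub_ne_zero]
      have hLS : v ((W.baseChange K).toAffine.slope (algebraMap R K p₁) (algebraMap R K p₂)
          (algebraMap R K q₁) (algebraMap R K q₂)) ≤ 1 := by
        rw [hslopeS, map_div₀, map_sub (algebraMap R K) p₁ p₂, hvD, div_one]; exact h1 _
      have hLD : v ((W.baseChange K).toAffine.slope (algebraMap R K p₁) (algebraMap R K p₂)
          (algebraMap R K q₁) ((W.baseChange K).toAffine.negY (algebraMap R K p₂)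
            (algebraMap R K q₂))) ≤ 1 := by
        rw [hnegY, hslopeD, map_div₀, map_sub (algebraMap R K) p₁ p₂, hvD, div_one]; exact h1 _
      rw [max_eq_left (v_addX_le_one hv hx₁ hx₂ hLS), max_eq_left (v_addX_le_one hv hx₁ hx₂ hLD),
        hvD, one_pow, mul_one, mul_one]

end Law

end Literature.NumberTheory.EllipticCurves
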